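import Summits.BirchSwinnertonDyer.Rank1Residual.X12.CMRamifiedRecordSchemaG
import HarnessLib

/-!
# Leaf `CornerF ∧ CMRamified`, slice `p = 3`: PART F/G addendum — MODEL GLUE from Cremona's reduced
# minimal model of a `j = 0` curve to the records' Mordell model `y² = x³ + k` (so the PART F §1 bridge
# applies to a NAMED curve `⟨0, 0, a₃, 0, a₆⟩` without hand computation)

HONEST FRAMING (cell `bsd-print-cfram`, run/shared/lean/pub/bsd-print-cfram/, verbatim in every file
of the cell): PARTITION currency only — the leaf counts when its class theorem is in the kernel BY
NAME, flag-free; Literature named facts are statement-only with cite tags, never sorried theorems;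
every imported theorem carries its printed hypotheses verbatim; numbers, not adjectives. THIS FILE IS
STRUCTURE: theorems only, no definition, no named fact, nothing about any particular curve; no mark
moves (the leaf K12r, its `p = 3` slice and the regime children N / T / V of route `PrintCFram` stay OPEN).

WHAT IS HERE. Every `j = 0` curve over `ℚ` has reduced minimal model `[0, 0, a₃, 0, a₆]` with
`a₃ ∈ {0, 1}` (`c₄ = 0` forces `a₁ = a₂ = a₄ = 0` on a reduced model); on the 919 K12r@3 classes of
PART F: `a₃ = 0` on 574 (then `k = a₆`, scalings `u₁ = u₂ = 1`) and `a₃ = 1` on 345 (then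
`k = 64a₆ + 16`, `u₁ = 2`). The two variable changes: `smul_eq_mordellCurve_of_a3_zero`
(`1 • ⟨0,0,0,0,a₆⟩ = E_{a₆}`) and **`smul_eq_mordellCurve_of_a3_one`** (`(u, r, s, t) = (½, 0, 0, −½)`:
`⟨0,0,1,0,a₆⟩ ↦ E_{64a₆+16}`, i.e. `y ↦ (y' − 4)/8`, `x ↦ x'/4`); and the bridge COROLLARIES for a named
minimal model: `tBit_eq_false_iff_binders_of_a3_zero` / `_of_a3_one` (record T-bit on `k` ⟺ both O11@3
binders of `⟨0,0,a₃,0,a₆⟩`), so a consistent PART E/F/G record with `ainvs = [0,0,a₃,0,a₆]` and its `k`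
decides `htors ∧ htors'` of Cremona's curve BY NAME (`PopRow.regime_*_iff`, `VRow.binders_of_consistent`,
`RegimeRow.regime_*_iff` take `hW` := these lemmas). beyond-print: NO.
-/

set_option autoImplicit false

namespace Summit.BirchSwinnertonDyer.Rank1Residual.X12.CMRamifiedRecords

open WeierstrassCurve Literature.NumberTheory.EllipticCurves

/-- `a₃ = 0`: Cremona's model IS the Mordell model, `1 • ⟨0,0,0,0,a₆⟩ = E_{a₆}`. [folklore] -/
theorem smul_eq_mordellCurve_of_a3_zero (a6 : ℚ) :
    (1 : VariableChange ℚ) • (⟨0, 0, 0, 0, a6⟩ : WeierstrassCurve ℚ) = mordellCurve a6 := by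
  rw [one_smul]; rfl

/-- `a₃ = 1`: the variable change `(u, r, s, t) = (½, 0, 0, −½)` carries `y² + y = x³ + a₆` to the
Mordell model `y² = x³ + (64a₆ + 16)` (`a₃' = u⁻³(a₃ + 2t) = 0`, `a₆' = u⁻⁶(a₆ − t·a₃ − t²) = 64(a₆ + ¼)`).
[folklore] -/
theorem smul_eq_mordellCurve_of_a3_one (a6 : ℚ) :
    (⟨Units.mk0 2⁻¹ (inv_ne_zero two_ne_zero), 0, 0, -2⁻¹⟩ : VariableChange ℚ) •
        (⟨0, 0, 1, 0, a6⟩ : WeierstrassCurve ℚ) = mordellCurve (64 * a6 + 16) := by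
  simp only [mordellCurve, variableChange_def, Units.val_inv_eq_inv_val, Units.val_mk0,
    WeierstrassCurve.mk.injEq]
  norm_num
  ring

section Curves

open scoped Classical

/-- **Bridge for a named minimal model, `a₃ = 0`**: for `W = ⟨0,0,0,0,k⟩` (`k ≠ 0` an integer) the
record T-bit `hasLocal3Tors k ∨ hasLocal3Tors (−27k)` is `false` iff both O11@3 binders of `W` hold.
[cite: SilvermanAEC2009, Exercise 3.7] -/
theorem tBit_eq_false_iff_binders_of_a3_zero {k : ℤ} (hk : k ≠ 0) :
    (hasLocal3Tors k || hasLocal3Tors (-27 * k)) = false ↔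
      ((∀ Q : ((⟨0, 0, 0, 0, (k : ℚ)⟩ : WeierstrassCurve ℚ).baseChange ℚ_[3]).toAffine.Point,
          (3 : ℕ) • Q = 0 → Q = 0) ∧
        (∀ Q : (((⟨0, 0, 0, 0, (k : ℚ)⟩ : WeierstrassCurve ℚ).quadraticTwist (-3 : ℚ)).baseChange
            ℚ_[3]).toAffine.Point, (3 : ℕ) • Q = 0 → Q = 0)) :=
  tBit_eq_false_iff_noThreeTorsion_pair _ hk (smul_eq_mordellCurve_of_a3_zero (k : ℚ))

/-- **Bridge for a named minimal model, `a₃ = 1`**: for `W = ⟨0,0,1,0,a₆⟩` (`a₆` an integer,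
`k = 64a₆ + 16`) the record T-bit on `k` is `false` iff both O11@3 binders of `W` hold. [cite: SilvermanAEC2009, Exercise 3.7] -/
theorem tBit_eq_false_iff_binders_of_a3_one (a6 : ℤ) :
    (hasLocal3Tors (64 * a6 + 16) || hasLocal3Tors (-27 * (64 * a6 + 16))) = false ↔
      ((∀ Q : ((⟨0, 0, 1, 0, (a6 : ℚ)⟩ : WeierstrassCurve ℚ).baseChange ℚ_[3]).toAffine.Point,
          (3 : ℕ) • Q = 0 → Q = 0) ∧
        (∀ Q : (((⟨0, 0, 1, 0, (a6 : ℚ)⟩ : WeierstrassCurve ℚ).quadraticTwist (-3 : ℚ)).baseChange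
            ℚ_[3]).toAffine.Point, (3 : ℕ) • Q = 0 → Q = 0)) := by
  have hk : (64 * a6 + 16 : ℤ) ≠ 0 := by omega
  have hW := smul_eq_mordellCurve_of_a3_one (a6 : ℚ)
  rw [show (64 * (a6 : ℚ) + 16) = ((64 * a6 + 16 : ℤ) : ℚ) by push_cast; ring] at hW
  exact tBit_eq_false_iff_noThreeTorsion_pair _ hk hW

/-- **Record reading for a named curve, `a₃ = 0`**: a consistent PART F record `r` with `r.k = k`
has `r.regime ≠ 1` iff both O11@3 binders of `⟨0,0,0,0,k⟩` hold. [cite: SilvermanAEC2009, Exercise 3.7] -/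
theorem PopRow.regime_ne_one_iff_of_a3_zero {r : PopRow} (h : r.consistent = true) :
    r.regime ≠ 1 ↔
      ((∀ Q : ((⟨0, 0, 0, 0, (r.k : ℚ)⟩ : WeierstrassCurve ℚ).baseChange ℚ_[3]).toAffine.Point,
          (3 : ℕ) • Q = 0 → Q = 0) ∧
        (∀ Q : (((⟨0, 0, 0, 0, (r.k : ℚ)⟩ : WeierstrassCurve ℚ).quadraticTwist (-3 : ℚ)).baseChange
            ℚ_[3]).toAffine.Point, (3 : ℕ) • Q = 0 → Q = 0)) :=
  PopRow.regime_ne_one_iff h _ (smul_eq_mordellCurve_of_a3_zero (r.k : ℚ))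

/-- **Record reading for a named curve, `a₃ = 1`**: a consistent PART F record `r` with
`r.k = 64a₆ + 16` has `r.regime ≠ 1` iff both O11@3 binders of `⟨0,0,1,0,a₆⟩` hold. [cite: SilvermanAEC2009, Exercise 3.7] -/
theorem PopRow.regime_ne_one_iff_of_a3_one {r : PopRow} (h : r.consistent = true) (a6 : ℤ)
    (hk : r.k = 64 * a6 + 16) :
    r.regime ≠ 1 ↔
      ((∀ Q : ((⟨0, 0, 1, 0, (a6 : ℚ)⟩ : WeierstrassCurve ℚ).baseChange ℚ_[3]).toAffine.Point,
          (3 : ℕ) • Q = 0 → Q = 0) ∧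
        (∀ Q : (((⟨0, 0, 1, 0, (a6 : ℚ)⟩ : WeierstrassCurve ℚ).quadraticTwist (-3 : ℚ)).baseChange
            ℚ_[3]).toAffine.Point, (3 : ℕ) • Q = 0 → Q = 0)) := by
  have hW := smul_eq_mordellCurve_of_a3_one (a6 : ℚ)
  rw [show (64 * (a6 : ℚ) + 16) = ((64 * a6 + 16 : ℤ) : ℚ) by push_cast; ring, ← hk] at hW
  exact PopRow.regime_ne_one_iff h _ hW

/-- Same for a consistent V record (PART G): both binders of the named minimal model hold, `a₃ = 0`. [cite: SilvermanAEC2009, Exercise 3.7] -/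
theorem VRow.binders_of_consistent_of_a3_zero {r : VRow} (h : r.consistent = true) :
    (∀ Q : ((⟨0, 0, 0, 0, (r.k : ℚ)⟩ : WeierstrassCurve ℚ).baseChange ℚ_[3]).toAffine.Point,
        (3 : ℕ) • Q = 0 → Q = 0) ∧
      (∀ Q : (((⟨0, 0, 0, 0, (r.k : ℚ)⟩ : WeierstrassCurve ℚ).quadraticTwist (-3 : ℚ)).baseChange
          ℚ_[3]).toAffine.Point, (3 : ℕ) • Q = 0 → Q = 0) :=
  (VRow.binders_of_consistent h _ (smul_eq_mordellCurve_of_a3_zero (r.k : ℚ))).1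

end Curves

end Summit.BirchSwinnertonDyer.Rank1Residual.X12.CMRamifiedRecords
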